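import Summits.QuantumFields.YangMills.Theorems.FluctuationComparisonRegPrIntLOrganTangentWindowDensity
import Summits.QuantumFields.YangMills.Theorems.FluctuationComparisonRegPrIntLOrganTangentChartVarianceRepresentation
import HarnessLib

/-!
# Crux `FluctuationComparisonRegPrIntL` (stmt-QuantumFields-20520, rung R3), PATH-B organ, v18 (H-currency) — (JV-rep) SELF-CONTAINED: the tilted fibre variance
# = the chart ratio at every window point, with the transfer data DISCHARGED by (WD) (the (A)-package and `lam` are ∀-bound in JVARᵘ-H″)

Cell `ym3-torus` (YM ladder rung R3 = continuum `SU(2)` Yang–Mills on the three-torus — a RUNG: NOT d = 4, NOT infinite volume, NOT a mass gap, NOT Clay).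
Width seat `ym-ust-20520-w5` (gen 23), `--supports stmt-QuantumFields-20520 --as helper`, count-neutral, no registry ∕ binder ∕ `Lines/` edit, DEFINITION-FREE,
default heartbeats.  ★★★`tiltedVariance_eq_chartRatio_on_window_self` = ✓`…ChartVarianceRepresentation.tiltedVariance_eq_chartRatio_on_window` with
`(rj, hrj, hrjpos, hcons)` supplied by ✓`…OrganTangentWindowDensity.exists_windowDensity_of_fibredChart` from the chart letters alone.

HONEST FRAMING: a two-line composition; nothing of Bałaban's analysis is asserted or proved; JVARᵘ-H″ ∕ (HV) ∕ SpreadFibreLawH(J) ∕ O1ᵘ-H v2.x OPEN; crux 20520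
`FluctuationComparisonRegPrIntL` ∕ `YM3TorusSU2` NOT proved; no summit ∕ sub-problem statement is proved; rung R3 = SU(2) YM₃ on T³ at fixed lattice data — NOT d = 4,
NOT infinite volume, NOT a mass gap, NOT Clay; the Yang–Mills mass gap is NOT proved.  [folklore].
-/

set_option autoImplicit false

noncomputable section


namespace Summit.QuantumFields.YangMills.Theorems.OrganTangentChartVarianceRepresentationSelf

open MeasureTheory ProbabilityTheory Filter Topology Set Function
open scoped ENNReal NNReal
open Literature.MathematicalPhysics.QuantumFieldTheory.Balaban1983to89
open T3ContinuumYM3Torus T3NestedUnitLaws T3UnitLawDensityEML T3UnitScaleTilt T3LevelShift T3TiltDescent T4Continuum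
open Literature.MathematicalPhysics.QuantumFieldTheory.Balaban1983to89.T3OrbitAverage
open Literature.MathematicalPhysics.QuantumFieldTheory.Balaban1983to89.T3DescentFibreTower (descendTo_self)
open Summit.QuantumFields.YangMills.Theorems.OrganTangentFibreMeanTools
open Summit.QuantumFields.YangMills.Theorems.FluctuationComparisonRegPrIntLOrganTangentAPackageDescendTo
  (measurableSet_multiWindow absolutelyContinuous_map_descendTo)
open Summit.QuantumFields.YangMills.Theorems.OrganTangentChartRepresentation (chartIntegrals_descendTo_of_fibredChart)
open Summit.QuantumFields.YangMills.Theorems.OrganTangentChartVarianceRepresentation (tiltedVariance_eq_chartRatio_on_window)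
open Summit.QuantumFields.YangMills.Theorems.OrganTangentWindowDensity (exists_windowDensity_of_fibredChart)

/-- ★★★ **(JV-rep) WITH THE TRANSFER DATA DISCHARGED** by (WD) `exists_windowDensity_of_fibredChart` (the (A)-package and `lam` are ∀-bound in JVARᵘ-H″, so no
cut-tower law is available — the chart letters alone supply the window density). [cite: Balaban1987RG1, (0.13) p.254; Balaban1985Averaging, (10)-(13) p.19] -/
theorem tiltedVariance_eq_chartRatio_on_window_self
    (F : T3Family) (γ b₀ p₀ : ℝ) (j K : ℕ) (hjK : j + 1 ≤ K) (hθ : 0 < θBal F.L γ b₀ p₀ K)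
    (r r' : GaugeField (F.P K) 0 ↥(Matrix.specialUnitaryGroup (Fin 2) ℂ) → ℝ) (hrm : Measurable r) (hrm' : Measurable r')
    (hpos : ∀ U, PlaqSmall (θBal F.L γ b₀ p₀ K) U → 0 < r U ∧ 0 < r' U)
    (hr : ContinuousOn r {U | PlaqSmall (θBal F.L γ b₀ p₀ K) U})
    (hr' : ContinuousOn r' {U | PlaqSmall (θBal F.L γ b₀ p₀ K) U})
    (χ : GaugeField (F.P K) 0 ↥(Matrix.specialUnitaryGroup (Fin 2) ℂ) → ℝ) (hχc : Continuous χ) (hχ0 : ∀ U, 0 ≤ χ U)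
    (hχsupp : ∀ U, χ U ≠ 0 → ∀ (n : ℕ) (hjn : j + 1 ≤ n) (hnK : n ≤ K), PlaqSmall (24 / 25 * θBal F.L γ b₀ p₀ n) (descendTo F ℰp n K hnK U))
    (hχpos : ∀ U, (∀ (n : ℕ) (hjn : j + 1 ≤ n) (hnK : n ≤ K), PlaqSmall (24 / 25 * θBal F.L γ b₀ p₀ n) (descendTo F ℰp n K hnK U)) → 0 < χ U)
    (σ₀ : Kernel (GaugeField (F.P j) 0 ↥(Matrix.specialUnitaryGroup (Fin 2) ℂ))
      (GaugeField (F.P K) 0 ↥(Matrix.specialUnitaryGroup (Fin 2) ℂ)))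
    (hσ₀M : IsMarkovKernel σ₀)
    (hbind₀ : (Measure.map (descendTo F ℰp j K (Nat.le_of_succ_le hjK)) (fieldMeasure (F.P K) 0 ↥(Matrix.specialUnitaryGroup (Fin 2) ℂ))).bind ⇑σ₀ =
      fieldMeasure (F.P K) 0 ↥(Matrix.specialUnitaryGroup (Fin 2) ℂ))
    (hfib₀ : ∀ᵐ V ∂(Measure.map (descendTo F ℰp j K (Nat.le_of_succ_le hjK)) (fieldMeasure (F.P K) 0 ↥(Matrix.specialUnitaryGroup (Fin 2) ℂ))),
      ∀ᵐ U ∂(σ₀ V), descendTo F ℰp j K (Nat.le_of_succ_le hjK) U = V)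
    (lam : GaugeField (F.P j) 0 ↥(Matrix.specialUnitaryGroup (Fin 2) ℂ) →
      Measure (GaugeField (F.P K) 0 ↥(Matrix.specialUnitaryGroup (Fin 2) ℂ)))
    (hlam : ∀ V, IsFiniteMeasure (lam V))
    (hA1 : ∀ f : GaugeField (F.P K) 0 ↥(Matrix.specialUnitaryGroup (Fin 2) ℂ) → ℝ, Continuous f →
      (∀ U, f U ≠ 0 → ∀ (n : ℕ) (hjn : j + 1 ≤ n) (hnK : n ≤ K), PlaqSmall (24 / 25 * θBal F.L γ b₀ p₀ n) (descendTo F ℰp n K hnK U)) →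
      ContinuousOn (fun V => ∫ U, f U ∂(lam V)) {V | PlaqSmall (θBal F.L γ b₀ p₀ j) V})
    (hA2 : ∀ V, PlaqSmall (θBal F.L γ b₀ p₀ j) V → 0 < lam V {U | ∀ (n : ℕ) (hjn : j + 1 ≤ n) (hnK : n ≤ K), PlaqSmall (24 / 25 * θBal F.L γ b₀ p₀ n) (descendTo F ℰp n K hnK U)})
    (hA3 : ∃ c : GaugeField (F.P j) 0 ↥(Matrix.specialUnitaryGroup (Fin 2) ℂ) → ℝ,
      ∀ f : GaugeField (F.P K) 0 ↥(Matrix.specialUnitaryGroup (Fin 2) ℂ) → ℝ, Continuous f →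
        (∀ U, ¬ (∀ (n : ℕ) (hjn : j + 1 ≤ n) (hnK : n ≤ K), PlaqSmall (24 / 25 * θBal F.L γ b₀ p₀ n) (descendTo F ℰp n K hnK U)) → f U = 0) →
        ∀ᵐ V ∂(Measure.map (descendTo F ℰp j K (Nat.le_of_succ_le hjK)) (fieldMeasure (F.P K) 0 ↥(Matrix.specialUnitaryGroup (Fin 2) ℂ))),
          PlaqSmall (θBal F.L γ b₀ p₀ j) V → 0 < c V ∧ ∫ U, f U ∂(σ₀ V) = c V * ∫ U, f U ∂(lam V))
    {Z : Type*} [MeasurableSpace Z] (τ : Measure Z) [SFinite τ]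
    (Φ : GaugeField (F.P j) 0 ↥(Matrix.specialUnitaryGroup (Fin 2) ℂ) × Z → GaugeField (F.P K) 0 ↥(Matrix.specialUnitaryGroup (Fin 2) ℂ))
    (hΦ : Measurable Φ)
    (J : GaugeField (F.P j) 0 ↥(Matrix.specialUnitaryGroup (Fin 2) ℂ) × Z → ℝ≥0) (hJ : Measurable J)
    (S : Set (GaugeField (F.P K) 0 ↥(Matrix.specialUnitaryGroup (Fin 2) ℂ)))
    (hS : ∀ U, (∀ (n : ℕ) (hjn : j + 1 ≤ n) (hnK : n ≤ K), PlaqSmall (24 / 25 * θBal F.L γ b₀ p₀ n) (descendTo F ℰp n K hnK U)) → U ∈ S)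
    (havgΦ : ∀ V ∈ {V | PlaqSmall (θBal F.L γ b₀ p₀ j) V}, ∀ z, descendTo F ℰp j K (Nat.le_of_succ_le hjK) (Φ (V, z)) = V)
    (hmap : (fieldMeasure (F.P K) 0 ↥(Matrix.specialUnitaryGroup (Fin 2) ℂ)).restrict
        (descendTo F ℰp j K (Nat.le_of_succ_le hjK) ⁻¹' {V | PlaqSmall (θBal F.L γ b₀ p₀ j) V} ∩ S) =
      ((((fieldMeasure (F.P j) 0 ↥(Matrix.specialUnitaryGroup (Fin 2) ℂ)).restrict {V | PlaqSmall (θBal F.L γ b₀ p₀ j) V}).prod τ).withDensity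
        (fun p => (J p : ℝ≥0∞))).map Φ)
    (hint : ∀ f : GaugeField (F.P K) 0 ↥(Matrix.specialUnitaryGroup (Fin 2) ℂ) → ℝ, Continuous f →
      (∀ U, f U ≠ 0 → ∀ (n : ℕ) (hjn : j + 1 ≤ n) (hnK : n ≤ K), PlaqSmall (24 / 25 * θBal F.L γ b₀ p₀ n) (descendTo F ℰp n K hnK U)) →
      ∀ᵐ z ∂τ, ContinuousOn (fun V => (J (V, z) : ℝ) * f (Φ (V, z))) {V | PlaqSmall (θBal F.L γ b₀ p₀ j) V})
    (B : Z → ℝ) (hB : Integrable B τ)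
    (hJB : ∀ V, PlaqSmall (θBal F.L γ b₀ p₀ j) V → ∀ᵐ z ∂τ, (J (V, z) : ℝ) ≤ B z)
    (hmass : ∀ V, PlaqSmall (θBal F.L γ b₀ p₀ j) V →
      0 < ∫⁻ z in {z | ∀ (n : ℕ) (hjn : j + 1 ≤ n) (hnK : n ≤ K), PlaqSmall (24 / 25 * θBal F.L γ b₀ p₀ n) (descendTo F ℰp n K hnK (Φ (V, z)))},
        (J (V, z) : ℝ≥0∞) ∂τ) :
    ∀ V, PlaqSmall (θBal F.L γ b₀ p₀ j) V → ∀ t : ℝ,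
      variance (fun U => Real.log (r U) - Real.log (r' U))
          (((lam V).withDensity (fun U => ENNReal.ofReal (χ U * r' U))).tilted (fun U => t * (Real.log (r U) - Real.log (r' U))))
        = (∫ z, (Real.log (r (Φ (V, z))) - Real.log (r' (Φ (V, z)))
              - (∫ z', (Real.log (r (Φ (V, z'))) - Real.log (r' (Φ (V, z'))))
                  * (χ (Φ (V, z')) * (Real.rpow (r (Φ (V, z'))) t * Real.rpow (r' (Φ (V, z'))) (1 - t)) * (J (V, z') : ℝ)) ∂τ)
                / (∫ z', χ (Φ (V, z')) * (Real.rpow (r (Φ (V, z'))) t * Real.rpow (r' (Φ (V, z'))) (1 - t)) * (J (V, z') : ℝ) ∂τ)) ^ 2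
            * (χ (Φ (V, z)) * (Real.rpow (r (Φ (V, z))) t * Real.rpow (r' (Φ (V, z))) (1 - t)) * (J (V, z) : ℝ)) ∂τ)
          / (∫ z, χ (Φ (V, z)) * (Real.rpow (r (Φ (V, z))) t * Real.rpow (r' (Φ (V, z))) (1 - t)) * (J (V, z) : ℝ) ∂τ) := by
  obtain ⟨rj, hrj, hrjpos, hcons⟩ := exists_windowDensity_of_fibredChart F γ b₀ p₀ j K (Nat.le_of_succ_le hjK) τ Φ hΦ J hJ S havgΦ hmap hmass
  exact tiltedVariance_eq_chartRatio_on_window F γ b₀ p₀ j K hjK hθ r r' hrm hrm' hpos hr hr' χ hχc hχ0 hχsupp hχpos σ₀ hσ₀M hbind₀ hfib₀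
    lam hlam hA1 hA2 hA3 τ Φ hΦ J hJ S hS havgΦ hmap hint B hB hJB hmass rj hrj hrjpos hcons

end Summit.QuantumFields.YangMills.Theorems.OrganTangentChartVarianceRepresentationSelf

end
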